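import Summits.Parity.BatemanHorn.Theorems.SoloInformedLocatedPrimeModuli
import Summits.Parity.BatemanHorn.Theorems.SoloInformedLocatedWindowMass
import Summits.Parity.BatemanHorn.Theorems.SoloInformedLargestPrimePassive

/-!
# Near-prime moduli carry `O(β)` of the located root count: the bilinear-localisation cost

Informed soloist `solo-Parity-informed` (session 146, Q32), conjunct `BatemanHorn`, the `d ≥ 3` rung BELOW the
parity wall.  For an irreducible `g ∈ ℤ[X]` of degree `d ≥ 2` the located root count
`Mid_g(x) = #{(n, e) : n ≤ x < e, e ∣ g(n), e² < |g(n)|}` (`polyLocatedRootCount`) is conjecturally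
`((d−2)/2)·A_g·x log x` (`LocatedRootCountAsymptotic`, equivalent to Erdős's asymptotic for `∑τ(|g(n)|)`).

`SoloInformedLocatedPrimeModuli` showed that PRIME moduli carry only `O(x)` of `Mid_g`.  Here the same is done
one parameter deeper: call a modulus `e` NEAR-PRIME at level `y` if its cofactor to the largest prime factor is
small, `e < y·P⁺(e)` (i.e. `e/P⁺(e) < y`), and let `Mid_g(x; y)` (`polyLocatedNearPrimeCount g x y`) count the
located pairs with a near-prime modulus.

* `card_nearPrime_filter_le` — the injection `e ↦ (P⁺(e), e/P⁺(e))`: for `N ≠ 0`, `x ≥ 1`, the near-prime located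
  divisors of `N` are at most `#{p ∣ N prime : x < p·y} · #{m ∣ N : m ≤ y}`;
* `card_mul_log_le_log_of_subset_primeFactors` — `#P·log z ≤ log N` for primes `P ∣ N` all `≥ z` (real `z ≥ 1`);
* `sum_card_divisors_le_le` — `∑_{n≤x} #{m ∣ g(n) : m ≤ y} ≤ x·L_g(y) + ∑_{m≤y} ρ_g(m)`;
* `exists_polyLocatedNearPrimeCount_mul_log_le` — hence, for `1 ≤ y ≤ x`,
  `Mid_g(x; y)·log(x/y) ≤ (d·log x + B_g)·(x·L_g(y) + ∑_{m≤y} ρ_g(m))`;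
* **`exists_polyLocatedNearPrimeCount_rpow_le`** — THE COST OF LOCALISING: for `0 < β < 1` there is `K` with
  `Mid_g(x; ⌊x^β⌋) ≤ (d·A_g·β/(1−β))·x log x + K·x` for all `x ≥ 2`
  (`L_g(⌊x^β⌋) = β·A_g·log x + O(1)`, `SoloInformedLocatedWindowMass`; `∑_{m≤x} ρ_g(m) = O(x)`);
* the companion file `SoloInformedNearPrimeReduction` turns this into the equivalence
  `ERDŐS(g) ⟺ ∃ L ∀ β ∈ (0,1/2): limsup_x |(Mid_g(x) − Mid_g(x;⌊x^β⌋))/(x log x) − ((d−2)/2)·A_g| ≤ L·β`.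

Reading (SHARPEST-STATEMENT §4.A of the line; prose).  "Discard the near-prime moduli first" — the standard opening
of every bilinear treatment, which needs a factorisation `e = m·p` with BOTH factors of flexible size — is a kernel
REDUCTION with an explicit price `d·A_g·β/(1−β)` per unit of `x log x`, against the target `((d−2)/2)·A_g`.  This
also fixes the exact scope of the no-go `not_classwiseMeanProfile_largestPrimeFactor` (`SoloInformedLargestPrimePassive`):
its witnesses are the prime moduli, which are removable at cost `O(β)`; so that theorem constrains class-wise
statements over ALL moduli of a dyadic block, not the rung itself — after localisation to `e/P⁺(e) ≥ x^β` every
`P⁺`-class has many moduli and Fejér positivity is silent.  Nothing here touches a parity-blocked statement.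
-/

namespace Summit.Parity.BatemanHorn.Theorems

open Finset Filter Polynomial Literature.NumberTheory.Sieve
open Literature.Barriers.ABC (largestPrimeFactor largestPrimeFactor_def)
open scoped Topology

/-! ### The largest prime factor -/

/-- `P⁺(n) ∣ n` for every `n` (with `P⁺(0) = P⁺(1) = 1`). [folklore] -/
theorem largestPrimeFactor_dvd_self (n : ℕ) : largestPrimeFactor n ∣ n := by
  rcases n.primeFactors.eq_empty_or_nonempty with h0 | hne
  · rw [largestPrimeFactor_def, h0, sup_empty, Nat.bot_eq_zero, max_eq_left zero_le_one]
    exact one_dvd n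
  · obtain ⟨q, hq, hsup⟩ := exists_mem_eq_sup _ hne id
    have hq2 : 2 ≤ q := (Nat.prime_of_mem_primeFactors hq).two_le
    rw [largestPrimeFactor_def, hsup, id_eq, max_eq_right (by omega : 1 ≤ q)]
    exact Nat.dvd_of_mem_primeFactors hq

/-- For `e ≥ 2`, `P⁺(e)` is a prime factor of `e`. [folklore] -/
theorem largestPrimeFactor_mem_primeFactors {e : ℕ} (he : 2 ≤ e) : largestPrimeFactor e ∈ e.primeFactors := by
  have hne : e.primeFactors.Nonempty := Nat.nonempty_primeFactors.mpr he
  obtain ⟨q, hq, hsup⟩ := exists_mem_eq_sup _ hne id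
  have hq2 : 2 ≤ q := (Nat.prime_of_mem_primeFactors hq).two_le
  rw [largestPrimeFactor_def, hsup, id_eq, max_eq_right (by omega : 1 ≤ q)]
  exact hq

/-! ### The near-prime located count -/

/-- The located root count on NEAR-PRIME moduli at level `y`: pairs `(n, e)` with `1 ≤ n ≤ x`, `e ∣ g(n)`, `x < e`,
`e² < |g(n)|` and `e < y·P⁺(e)` (cofactor to the largest prime factor below `y`). -/
def polyLocatedNearPrimeCount (g : ℤ[X]) (x y : ℕ) : ℕ :=
  ∑ n ∈ Icc 1 x,
    #(((g.eval (n : ℤ)).natAbs.divisors).filter fun e =>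
        x < e ∧ e * e < (g.eval (n : ℤ)).natAbs ∧ e < y * largestPrimeFactor e)

/-- The near-prime located count is at most the located root count. -/
theorem polyLocatedNearPrimeCount_le (g : ℤ[X]) (x y : ℕ) :
    polyLocatedNearPrimeCount g x y ≤ polyLocatedRootCount g x := by
  unfold polyLocatedNearPrimeCount polyLocatedRootCount
  refine sum_le_sum fun n _ => card_le_card fun e he => ?_
  rw [Finset.mem_filter] at he ⊢
  exact ⟨he.1, he.2.1, he.2.2.1⟩

/-- Prime moduli are near-prime at every level `y ≥ 2`: `MidPrime_g(x) ≤ Mid_g(x; y)`. -/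
theorem polyLocatedPrimeCount_le_nearPrime (g : ℤ[X]) (x : ℕ) {y : ℕ} (hy : 2 ≤ y) :
    polyLocatedPrimeCount g x ≤ polyLocatedNearPrimeCount g x y := by
  unfold polyLocatedPrimeCount polyLocatedNearPrimeCount
  refine sum_le_sum fun n _ => card_le_card fun e he => ?_
  rw [Finset.mem_filter] at he
  rw [Finset.mem_filter]
  obtain ⟨he', hp⟩ := he
  rw [Finset.mem_filter] at he'
  refine ⟨he'.1, he'.2.1, he'.2.2, ?_⟩
  rw [largestPrimeFactor_prime hp]
  have h2 : 2 * e ≤ y * e := Nat.mul_le_mul_right e hy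
  have he1 : 1 ≤ e := hp.one_lt.le
  linarith

/-- **The injection `e ↦ (P⁺(e), e/P⁺(e))`**: for `N ≠ 0` and `x ≥ 1`, the near-prime located divisors of `N` at level
`y` number at most `#{p ∣ N prime : x < p·y} · #{m ∣ N : m ≤ y}`. -/
theorem card_nearPrime_filter_le {N x : ℕ} (hN : N ≠ 0) (hx : 1 ≤ x) (y : ℕ) :
    #(N.divisors.filter fun e => x < e ∧ e * e < N ∧ e < y * largestPrimeFactor e)
      ≤ #(N.primeFactors.filter fun p => x < p * y) * #(N.divisors.filter fun m => m ≤ y) := by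
  rw [← Finset.card_product]
  refine Finset.card_le_card_of_injOn (fun e => (largestPrimeFactor e, e / largestPrimeFactor e)) ?_ ?_
  · intro e he
    rw [Finset.mem_coe, Finset.mem_filter, Nat.mem_divisors] at he
    obtain ⟨⟨heN, -⟩, hxe, -, hey⟩ := he
    have he2 : 2 ≤ e := by omega
    have hp := largestPrimeFactor_mem_primeFactors he2
    have hpp : (largestPrimeFactor e).Prime := Nat.prime_of_mem_primeFactors hp
    have hpe : largestPrimeFactor e ∣ e := Nat.dvd_of_mem_primeFactors hp
    rw [Finset.mem_coe, Finset.mem_product, Finset.mem_filter, Finset.mem_filter, Nat.mem_primeFactors,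
      Nat.mem_divisors]
    refine ⟨⟨⟨hpp, hpe.trans heN, hN⟩, ?_⟩, ⟨(Nat.div_dvd_of_dvd hpe).trans heN, hN⟩, ?_⟩
    · rw [mul_comm]
      exact hxe.trans hey
    · exact ((Nat.div_lt_iff_lt_mul hpp.pos).mpr hey).le
  · intro e₁ _ e₂ _ h
    simp only [Prod.mk.injEq] at h
    obtain ⟨h1, h2⟩ := h
    calc e₁ = e₁ / largestPrimeFactor e₁ * largestPrimeFactor e₁ :=
          (Nat.div_mul_cancel (largestPrimeFactor_dvd_self e₁)).symm
      _ = e₂ / largestPrimeFactor e₂ * largestPrimeFactor e₂ := by rw [h2, h1]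
      _ = e₂ := Nat.div_mul_cancel (largestPrimeFactor_dvd_self e₂)

/-- **Few prime factors beyond a real threshold**: if `P` is a set of prime factors of `N ≠ 0`, all `≥ z ≥ 1`, then
`#P · log z ≤ log N`. -/
theorem card_mul_log_le_log_of_subset_primeFactors {N : ℕ} (hN : N ≠ 0) {z : ℝ} (hz : 1 ≤ z)
    (P : Finset ℕ) (hP : P ⊆ N.primeFactors) (hzP : ∀ p ∈ P, z ≤ (p : ℝ)) :
    (#P : ℝ) * Real.log z ≤ Real.log N := by
  have hdvd : ∏ p ∈ P, p ∣ N :=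
    (Finset.prod_dvd_prod_of_subset P N.primeFactors (fun p => p) hP).trans (Nat.prod_primeFactors_dvd N)
  have hle : ∏ p ∈ P, p ≤ N := Nat.le_of_dvd (Nat.pos_of_ne_zero hN) hdvd
  have hpos : ∀ p ∈ P, (0 : ℝ) < p := fun p hp => by
    exact_mod_cast (Nat.prime_of_mem_primeFactors (hP hp)).pos
  have hprodpos : (0 : ℝ) < ∏ p ∈ P, (p : ℝ) := prod_pos hpos
  have hleR : (∏ p ∈ P, (p : ℝ)) ≤ (N : ℝ) := by
    have h := (Nat.cast_le (α := ℝ)).mpr hle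
    rwa [Nat.cast_prod] at h
  have hlogprod : Real.log (∏ p ∈ P, (p : ℝ)) ≤ Real.log N := Real.log_le_log hprodpos hleR
  rw [Real.log_prod (s := P) (f := fun p : ℕ => (p : ℝ)) (fun p hp => (hpos p hp).ne')] at hlogprod
  have hterm : ∀ p ∈ P, Real.log z ≤ Real.log (p : ℝ) := fun p hp =>
    Real.log_le_log (by linarith) (hzP p hp)
  have hcard := Finset.card_nsmul_le_sum P (fun p : ℕ => Real.log (p : ℝ)) (Real.log z) hterm
  rw [nsmul_eq_mul] at hcard
  linarith

/-- **Small divisors along `g`, swapped**: `∑_{n≤x} #{m ∣ g(n) : m ≤ y} = ∑_{m≤y} #{n ≤ x : m ∣ g(n)} ≤ x·L_g(y) + ∑_{m≤y} ρ_g(m)`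
(when `g` has no zero in `[1, x]`). -/
theorem sum_card_divisors_le_le (g : ℤ[X]) {x : ℕ} (hg0 : ∀ n ∈ Icc 1 x, g.eval (n : ℤ) ≠ 0) (y : ℕ) :
    ∑ n ∈ Icc 1 x, (#(((g.eval (n : ℤ)).natAbs.divisors).filter fun m => m ≤ y) : ℝ)
      ≤ (x : ℝ) * polySmallLevel g y + ∑ m ∈ Icc 1 y, (polyRootCountMod ![g] m : ℝ) := by
  have hswap : ∑ n ∈ Icc 1 x, #(((g.eval (n : ℤ)).natAbs.divisors).filter fun m => m ≤ y)
      = ∑ m ∈ Icc 1 y, #((Icc 1 x).filter fun n : ℕ => (m : ℤ) ∣ g.eval (n : ℤ)) := by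
    have h1 : ∀ n ∈ Icc 1 x, #(((g.eval (n : ℤ)).natAbs.divisors).filter fun m => m ≤ y)
        = ∑ m ∈ Icc 1 y, if (m : ℤ) ∣ g.eval (n : ℤ) then 1 else 0 := by
      intro n hn
      rw [divisors_filter_le_eq_Icc_filter (Int.natAbs_ne_zero.mpr (hg0 n hn)) y, card_filter]
      refine sum_congr rfl fun m _ => ?_
      simp only [Int.natCast_dvd]
    rw [sum_congr rfl h1, sum_comm]
    refine sum_congr rfl fun m _ => ?_
    rw [card_filter]
  rw [← Nat.cast_sum, hswap, Nat.cast_sum, polySmallLevel, mul_sum, ← sum_add_distrib]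
  refine sum_le_sum fun m hm => ?_
  have hm0 : 0 < m := (mem_Icc.mp hm).1
  have h := (abs_le.mp (abs_card_filter_dvd_eval_sub_le g hm0 x)).2
  rw [mul_div_assoc] at h
  linarith

/-- **The near-prime located count, uniform bound**: for `g` irreducible of degree `≥ 2` there is `B ≥ 0` with
`Mid_g(x; y) · log(x/y) ≤ (d·log x + B)·(x·L_g(y) + ∑_{m≤y} ρ_g(m))` for all `1 ≤ y ≤ x`. [this work] -/
theorem exists_polyLocatedNearPrimeCount_mul_log_le {g : ℤ[X]} (hirr : Irreducible g) (hdeg : 2 ≤ g.natDegree) :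
    ∃ B : ℝ, 0 ≤ B ∧ ∀ x y : ℕ, 1 ≤ y → y ≤ x →
      (polyLocatedNearPrimeCount g x y : ℝ) * Real.log ((x : ℝ) / y)
        ≤ ((g.natDegree : ℝ) * Real.log x + B)
          * ((x : ℝ) * polySmallLevel g y + ∑ m ∈ Icc 1 y, (polyRootCountMod ![g] m : ℝ)) := by
  have hdeg0 : 0 < g.natDegree := by omega
  obtain ⟨B, hB⟩ := exists_abs_log_natAbs_eval_sub_le hdeg0
  have hB0 : 0 ≤ B := le_trans (abs_nonneg _) (hB 1 le_rfl)
  refine ⟨B, hB0, fun x y hy hyx => ?_⟩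
  have hx1 : 1 ≤ x := hy.trans hyx
  have hxR : (1 : ℝ) ≤ x := by exact_mod_cast hx1
  have hyR : (1 : ℝ) ≤ y := by exact_mod_cast hy
  have hyxR : (y : ℝ) ≤ x := by exact_mod_cast hyx
  have hy0 : (0 : ℝ) < y := by linarith
  have hz1 : (1 : ℝ) ≤ (x : ℝ) / y := by rw [le_div_iff₀ hy0, one_mul]; exact hyxR
  have hlogz : 0 ≤ Real.log ((x : ℝ) / y) := Real.log_nonneg hz1
  have hlogx : 0 ≤ Real.log (x : ℝ) := Real.log_nonneg hxR
  have hd0 : (0 : ℝ) ≤ g.natDegree := Nat.cast_nonneg _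
  have hcoef : 0 ≤ (g.natDegree : ℝ) * Real.log x + B := add_nonneg (mul_nonneg hd0 hlogx) hB0
  have hg0 : ∀ n ∈ Icc 1 x, g.eval (n : ℤ) ≠ 0 := fun n _ => eval_natCast_ne_zero_of_irreducible hirr hdeg n
  -- Step 1: per-`n` bound
  have hstep : ∀ n ∈ Icc 1 x,
      (#(((g.eval (n : ℤ)).natAbs.divisors).filter fun e =>
          x < e ∧ e * e < (g.eval (n : ℤ)).natAbs ∧ e < y * largestPrimeFactor e) : ℝ) * Real.log ((x : ℝ) / y)
        ≤ ((g.natDegree : ℝ) * Real.log x + B)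
            * (#(((g.eval (n : ℤ)).natAbs.divisors).filter fun m => m ≤ y) : ℝ) := by
    intro n hn
    have hn1 : 1 ≤ n := (mem_Icc.mp hn).1
    have hnx : n ≤ x := (mem_Icc.mp hn).2
    set N : ℕ := (g.eval (n : ℤ)).natAbs with hN
    have hN0 : N ≠ 0 := Int.natAbs_ne_zero.mpr (hg0 n hn)
    have hcnt := card_nearPrime_filter_le hN0 hx1 y
    have hA : (#(N.primeFactors.filter fun p => x < p * y) : ℝ) * Real.log ((x : ℝ) / y)
        ≤ (g.natDegree : ℝ) * Real.log x + B := by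
      have hzP : ∀ p ∈ N.primeFactors.filter (fun p => x < p * y), (x : ℝ) / y ≤ (p : ℝ) := by
        intro p hp
        rw [Finset.mem_filter] at hp
        rw [div_le_iff₀ hy0]
        exact_mod_cast hp.2.le
      have h1 := card_mul_log_le_log_of_subset_primeFactors hN0 hz1 _ (filter_subset _ _) hzP
      have h2 := (abs_le.mp (hB n hn1)).2
      have h3 : Real.log (n : ℝ) ≤ Real.log (x : ℝ) :=
        Real.log_le_log (by exact_mod_cast hn1) (by exact_mod_cast hnx)
      nlinarith [mul_le_mul_of_nonneg_left h3 hd0]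
    calc (#((N.divisors).filter fun e => x < e ∧ e * e < N ∧ e < y * largestPrimeFactor e) : ℝ)
            * Real.log ((x : ℝ) / y)
        ≤ ((#(N.primeFactors.filter fun p => x < p * y) * #(N.divisors.filter fun m => m ≤ y) : ℕ) : ℝ)
            * Real.log ((x : ℝ) / y) := mul_le_mul_of_nonneg_right (by exact_mod_cast hcnt) hlogz
      _ = (#(N.divisors.filter fun m => m ≤ y) : ℝ)
            * ((#(N.primeFactors.filter fun p => x < p * y) : ℝ) * Real.log ((x : ℝ) / y)) := by
          push_cast; ring
      _ ≤ (#(N.divisors.filter fun m => m ≤ y) : ℝ) * ((g.natDegree : ℝ) * Real.log x + B) :=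
          mul_le_mul_of_nonneg_left hA (Nat.cast_nonneg _)
      _ = ((g.natDegree : ℝ) * Real.log x + B) * (#(N.divisors.filter fun m => m ≤ y) : ℝ) := mul_comm _ _
  -- Step 2: sum over `n`
  have hsum : (polyLocatedNearPrimeCount g x y : ℝ) * Real.log ((x : ℝ) / y)
      ≤ ((g.natDegree : ℝ) * Real.log x + B)
          * ∑ n ∈ Icc 1 x, (#(((g.eval (n : ℤ)).natAbs.divisors).filter fun m => m ≤ y) : ℝ) := by
    unfold polyLocatedNearPrimeCount
    push_cast
    rw [sum_mul, mul_sum]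
    exact sum_le_sum hstep
  -- Step 3: the small-divisor sum
  exact hsum.trans (mul_le_mul_of_nonneg_left (sum_card_divisors_le_le g hg0 y) hcoef)

/-- **The bilinear-localisation cost.**  For `g` irreducible of degree `d ≥ 2` and `0 < β < 1` there is `K` with
`Mid_g(x; ⌊x^β⌋) ≤ (d·A_g·β/(1−β))·x log x + K·x` for all `x ≥ 2`: the located pairs whose modulus has cofactor
`e/P⁺(e) < ⌊x^β⌋` carry at most the share `d·β/(1−β)·A_g` of `x log x`, against the conjectured total
`((d−2)/2)·A_g`. [this work] -/
theorem exists_polyLocatedNearPrimeCount_rpow_le {g : ℤ[X]} (hirr : Irreducible g) (hdeg : 2 ≤ g.natDegree)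
    {β : ℝ} (hβ0 : 0 < β) (hβ1 : β < 1) :
    ∃ K : ℝ, ∀ x : ℕ, 2 ≤ x →
      (polyLocatedNearPrimeCount g x ⌊(x : ℝ) ^ β⌋₊ : ℝ)
        ≤ (g.natDegree : ℝ) * rootLevelConst g * β / (1 - β) * ((x : ℝ) * Real.log x) + K * x := by
  have hdeg0 : 0 < g.natDegree := by omega
  obtain ⟨B, hB0, hB⟩ := exists_polyLocatedNearPrimeCount_mul_log_le hirr hdeg
  obtain ⟨K₁, hK₁⟩ := exists_abs_polySmallLevel_rpow_sub_le hirr hdeg0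
  obtain ⟨C, hC0, hC⟩ := exists_sum_rootCount_le hirr hdeg0
  have hK₁0 : 0 ≤ K₁ := le_trans (abs_nonneg _) (hK₁ 1 le_rfl 0 le_rfl)
  have hA0 : 0 < rootLevelConst g := rootLevelConst_pos hirr hdeg0
  set d : ℝ := (g.natDegree : ℝ) with hd
  set A : ℝ := rootLevelConst g with hA
  have hd0 : 0 ≤ d := Nat.cast_nonneg _
  have hu0 : 0 < 1 - β := by linarith
  have hl2 : 0 < Real.log 2 := Real.log_pos (by norm_num)
  refine ⟨(d * (K₁ + C) + B * (β * A)) / (1 - β) + B * (K₁ + C) / ((1 - β) * Real.log 2), fun x hx => ?_⟩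
  have hx1 : 1 ≤ x := by omega
  have hxR1 : (1 : ℝ) ≤ x := by exact_mod_cast hx1
  have hxR2 : (2 : ℝ) ≤ x := by exact_mod_cast hx
  have hx0 : (0 : ℝ) < x := by linarith
  set Lx : ℝ := Real.log x with hLx
  have hLx2 : Real.log 2 ≤ Lx := Real.log_le_log (by norm_num) hxR2
  have hLx0 : 0 < Lx := lt_of_lt_of_le hl2 hLx2
  -- the level `y = ⌊x^β⌋`
  set y : ℕ := ⌊(x : ℝ) ^ β⌋₊ with hy
  have hxβ0 : (0 : ℝ) ≤ (x : ℝ) ^ β := Real.rpow_nonneg hx0.le β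
  have hxβ1 : (1 : ℝ) ≤ (x : ℝ) ^ β := by
    have h := Real.rpow_le_rpow_of_exponent_le hxR1 hβ0.le
    rwa [Real.rpow_zero] at h
  have hxβx : (x : ℝ) ^ β ≤ (x : ℝ) := by
    have h := Real.rpow_le_rpow_of_exponent_le hxR1 hβ1.le
    rwa [Real.rpow_one] at h
  have hy1 : 1 ≤ y := Nat.floor_pos.mpr hxβ1
  have hyx : y ≤ x := (Nat.floor_le_floor hxβx).trans (Nat.floor_natCast x).le
  have hyR1 : (1 : ℝ) ≤ y := by exact_mod_cast hy1
  have hy0 : (0 : ℝ) < y := by linarith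
  have hyle : (y : ℝ) ≤ (x : ℝ) ^ β := Nat.floor_le hxβ0
  -- `log(x/y) ≥ (1−β) log x`
  have hlogz : (1 - β) * Lx ≤ Real.log ((x : ℝ) / y) := by
    rw [Real.log_div hx0.ne' hy0.ne']
    have h1 : Real.log (y : ℝ) ≤ Real.log ((x : ℝ) ^ β) := Real.log_le_log hy0 hyle
    rw [Real.log_rpow hx0] at h1
    rw [hLx]
    linarith
  -- the level bound and the first-moment bound
  have hLy : polySmallLevel g y ≤ β * A * Lx + K₁ := by
    have h := (abs_le.mp (hK₁ x hx1 β hβ0.le)).2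
    rw [hLx, hA]
    linarith
  have hSy : ∑ m ∈ Icc 1 y, (polyRootCountMod ![g] m : ℝ) ≤ C * x := by
    have h1 : ∑ m ∈ Icc 1 y, (polyRootCountMod ![g] m : ℝ) ≤ ∑ m ∈ Icc 1 x, (polyRootCountMod ![g] m : ℝ) :=
      sum_le_sum_of_subset_of_nonneg (Icc_subset_Icc_right hyx) fun _ _ _ => Nat.cast_nonneg _
    have h2 := hC (x : ℝ) hxR2
    rw [Nat.floor_natCast] at h2
    exact h1.trans h2
  -- the main inequality `NP·(1−β)·log x ≤ (d log x + B)·x·(βA log x + K₁ + C)`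
  have hmain : (polyLocatedNearPrimeCount g x y : ℝ) * ((1 - β) * Lx)
      ≤ (d * Lx + B) * ((x : ℝ) * (β * A * Lx + K₁ + C)) := by
    have h1 := hB x y hy1 hyx
    have h2 : (polyLocatedNearPrimeCount g x y : ℝ) * ((1 - β) * Lx)
        ≤ (polyLocatedNearPrimeCount g x y : ℝ) * Real.log ((x : ℝ) / y) :=
      mul_le_mul_of_nonneg_left hlogz (Nat.cast_nonneg _)
    have hcoef : 0 ≤ d * Lx + B := add_nonneg (mul_nonneg hd0 hLx0.le) hB0
    have h3 : (x : ℝ) * polySmallLevel g y + ∑ m ∈ Icc 1 y, (polyRootCountMod ![g] m : ℝ)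
        ≤ (x : ℝ) * (β * A * Lx + K₁ + C) := by
      have := mul_le_mul_of_nonneg_left hLy hx0.le
      nlinarith
    exact h2.trans (h1.trans (mul_le_mul_of_nonneg_left h3 hcoef))
  -- algebra
  have hpos : 0 < (1 - β) * Lx := mul_pos hu0 hLx0
  refine le_of_mul_le_mul_right (hmain.trans ?_) hpos
  have hexp : (d * A * β / (1 - β) * ((x : ℝ) * Lx)
        + ((d * (K₁ + C) + B * (β * A)) / (1 - β) + B * (K₁ + C) / ((1 - β) * Real.log 2)) * x)
        * ((1 - β) * Lx)
      = d * β * A * (x * Lx * Lx) + (d * (K₁ + C) + B * (β * A)) * (x * Lx)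
        + B * (K₁ + C) * (x * Lx) / Real.log 2 := by
    field_simp
    ring
  rw [hexp]
  have hlhs : (d * Lx + B) * ((x : ℝ) * (β * A * Lx + K₁ + C))
      = d * β * A * (x * Lx * Lx) + (d * (K₁ + C) + B * (β * A)) * (x * Lx) + B * (K₁ + C) * x := by
    ring
  rw [hlhs]
  have hlast : B * (K₁ + C) * (x : ℝ) ≤ B * (K₁ + C) * (x * Lx) / Real.log 2 := by
    rw [le_div_iff₀ hl2]
    have hnn : 0 ≤ B * (K₁ + C) * (x : ℝ) := by positivity
    nlinarith [mul_le_mul_of_nonneg_left hLx2 hnn]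
  linarith

end Summit.Parity.BatemanHorn.Theorems
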